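import Mathlib.Analysis.Distribution.SchwartzSpace.Basic
import Mathlib.Analysis.Calculus.ContDiff.Bounds
import Mathlib.Analysis.Calculus.MeanValue
import Mathlib.Analysis.Complex.Trigonometric
import Mathlib.Analysis.SpecialFunctions.ExpDeriv
import HarnessLib

/-!
# Derivative estimates for exponentials of linear forms; Schwartz decay from exponential bounds

Topic `Literature/Analysis/Distribution`. Elementary toolkit for the Fourier–Laplace
representation of cone-supported tempered distributions (Hörmander Thm. 7.4.2 /
Streater–Wightman Thms. 2-6–2-9; sibling files), where the test functions are
`ξ ↦ χ(ξ) e^{-2πi⟨ξ, z⟩}` and their differences in `z`: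

* `norm_cexp_sub_one_le`, `norm_cexp_sub_one_sub_le`: `‖eˢ − 1‖ ≤ ‖s‖ e^{max(Re s, 0)}`,
  `‖eˢ − 1 − s‖ ≤ ‖s‖² e^{max(Re s, 0)}` (mean value inequality on the segment `[0, s]`);
* `norm_iteratedFDeriv_cexp_comp_le`: for a continuous `ℝ`-linear form `ℓ : E → ℂ`,
  `‖Dⁿ(exp ∘ ℓ)(x)‖ ≤ ‖e^{ℓ x}‖ ‖ℓ‖ⁿ` (induction: `D(exp ∘ ℓ) = (exp ∘ ℓ) • ℓ`), with the variants
  for `exp ∘ ℓ − 1` and `exp ∘ ℓ − 1 − ℓ` in positive order (`iteratedFDeriv_clm_eq_zero`: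
  `Dⁿℓ = 0` for `n ≥ 2`);
* `norm_iteratedFDeriv_mul_le_of_le`: the Leibniz bound in the form
  `‖Dⁿ(fg)(x)‖ ≤ 2ⁿ B_f B_g` when `‖Dⁱf(x)‖ ≤ B_f`, `‖Dⁱg(x)‖ ≤ B_g` for `i ≤ n`;
* `one_add_pow_mul_exp_neg_le` and `schwartz_decay_of_exp_bound`: a smooth function all of whose
  derivatives are `O((1 + ‖x‖)^N e^{-c‖x‖})` has the Schwartz decay property, with the explicit
  seminorm bound `seminorm_le_of_exp_bound`.

All statements are textbook calculus. [folklore]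

## Mathlib

Used: `Convex.norm_image_sub_le_of_norm_deriv_le`, `segment_eq_image'`, `Complex.norm_exp`,
`ContinuousLinearMap.iteratedFDeriv_comp_left`, `norm_iteratedFDeriv_fderiv`,
`norm_iteratedFDeriv_mul_le`, `Nat.sum_range_choose`, `Real.pow_div_factorial_le_exp`,
`SchwartzMap.seminorm_le_bound`.
-/

noncomputable section

open Set Filter
open _root_.Complex (exp)
open scoped ContDiff Topology

namespace Literature.Analysis.Distribution

/-! ### One complex variable: `eˢ − 1` and `eˢ − 1 − s` -/

/-- On the segment `[0, s]` the real part is at most `max (Re s) 0`. [folklore] -/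
theorem re_le_max_of_mem_segment {s t : ℂ} (ht : t ∈ segment ℝ (0 : ℂ) s) : t.re ≤ max s.re 0 := by
  rw [segment_eq_image'] at ht
  obtain ⟨θ, ⟨hθ0, hθ1⟩, rfl⟩ := ht
  simp only [sub_zero, zero_add, Complex.real_smul, Complex.mul_re, Complex.ofReal_re,
    Complex.ofReal_im, zero_mul, sub_zero]
  rcases le_or_gt 0 s.re with hs | hs
  · calc θ * s.re ≤ 1 * s.re := mul_le_mul_of_nonneg_right hθ1 hs
      _ = s.re := one_mul _
      _ ≤ max s.re 0 := le_max_left _ _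
  · calc θ * s.re ≤ 0 := mul_nonpos_of_nonneg_of_nonpos hθ0 hs.le
      _ ≤ max s.re 0 := le_max_right _ _

/-- On the segment `[0, s]` the norm is at most `‖s‖`. [folklore] -/
theorem norm_le_of_mem_segment {s t : ℂ} (ht : t ∈ segment ℝ (0 : ℂ) s) : ‖t‖ ≤ ‖s‖ := by
  rw [segment_eq_image'] at ht
  obtain ⟨θ, ⟨hθ0, hθ1⟩, rfl⟩ := ht
  simp only [sub_zero, zero_add, norm_smul, Real.norm_of_nonneg hθ0]
  exact mul_le_of_le_one_left (norm_nonneg _) hθ1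

/-- **`‖eˢ − 1‖ ≤ ‖s‖ e^{max(Re s, 0)}`** (mean value inequality on `[0, s]`, `|eᵗ| = e^{Re t}`).
[folklore] -/
theorem norm_cexp_sub_one_le (s : ℂ) : ‖exp s - 1‖ ≤ ‖s‖ * Real.exp (max s.re 0) := by
  have h := Convex.norm_image_sub_le_of_norm_deriv_le (f := exp) (s := segment ℝ (0 : ℂ) s)
    (C := Real.exp (max s.re 0)) (fun t _ => Complex.differentiable_exp t)
    (fun t ht => by
      rw [Complex.deriv_exp, Complex.norm_exp]
      exact Real.exp_le_exp.2 (re_le_max_of_mem_segment ht))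
    (convex_segment _ _) (left_mem_segment _ _ _) (right_mem_segment _ _ _)
  simpa [mul_comm] using h

/-- **`‖eˢ − 1 − s‖ ≤ ‖s‖² e^{max(Re s, 0)}`** (mean value inequality on `[0, s]` applied to
`t ↦ eᵗ − t`, whose derivative `eᵗ − 1` is bounded by the previous estimate). [folklore] -/
theorem norm_cexp_sub_one_sub_le (s : ℂ) : ‖exp s - 1 - s‖ ≤ ‖s‖ ^ 2 * Real.exp (max s.re 0) := by
  have hd : ∀ t : ℂ, HasDerivAt (fun t => exp t - t) (exp t - 1) t := fun t =>
    (Complex.hasDerivAt_exp t).sub (hasDerivAt_id t)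
  have h := Convex.norm_image_sub_le_of_norm_deriv_le (f := fun t => exp t - t)
    (s := segment ℝ (0 : ℂ) s) (C := ‖s‖ * Real.exp (max s.re 0))
    (fun t _ => (hd t).differentiableAt)
    (fun t ht => by
      rw [(hd t).deriv]
      calc ‖exp t - 1‖ ≤ ‖t‖ * Real.exp (max t.re 0) := norm_cexp_sub_one_le t
        _ ≤ ‖s‖ * Real.exp (max s.re 0) := by
          refine mul_le_mul (norm_le_of_mem_segment ht) (Real.exp_le_exp.2 ?_) (by positivity)
            (norm_nonneg _)
          exact max_le ((re_le_max_of_mem_segment ht)) (le_max_right _ _))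
    (convex_segment _ _) (left_mem_segment _ _ _) (right_mem_segment _ _ _)
  have e : exp s - 1 - s = (exp s - s) - (exp 0 - 0) := by simp; ring
  rw [e]
  calc ‖(exp s - s) - (exp 0 - 0)‖ ≤ ‖s‖ * Real.exp (max s.re 0) * ‖s - 0‖ := h
    _ = ‖s‖ ^ 2 * Real.exp (max s.re 0) := by rw [sub_zero]; ring

/-! ### Exponentials of continuous linear forms -/

section ExpLinear

variable {E : Type*} [NormedAddCommGroup E] [NormedSpace ℝ E]

/-- `exp ∘ ℓ` is smooth. [folklore] -/
theorem contDiff_cexp_comp (ℓ : E →L[ℝ] ℂ) {n : WithTop ℕ∞} : ContDiff ℝ n fun x => exp (ℓ x) :=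
  Complex.contDiff_exp.comp ℓ.contDiff

/-- `D(exp ∘ ℓ)(x) = e^{ℓ x} • ℓ`. [folklore] -/
theorem hasFDerivAt_cexp_comp (ℓ : E →L[ℝ] ℂ) (x : E) :
    HasFDerivAt (fun x => exp (ℓ x)) (exp (ℓ x) • ℓ) x := by
  have h : HasFDerivAt (fun x => exp (ℓ x))
      ((((1 : ℂ →L[ℂ] ℂ).smulRight (exp (ℓ x))).restrictScalars ℝ).comp ℓ) x :=
    ((Complex.hasDerivAt_exp (ℓ x)).hasFDerivAt.restrictScalars ℝ).comp x ℓ.hasFDerivAt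
  refine h.congr_fderiv ?_
  ext v
  simp [mul_comm]

/-- `fderiv` form of `hasFDerivAt_cexp_comp`. [folklore] -/
theorem fderiv_cexp_comp (ℓ : E →L[ℝ] ℂ) :
    fderiv ℝ (fun x => exp (ℓ x)) = fun x => exp (ℓ x) • ℓ :=
  funext fun x => (hasFDerivAt_cexp_comp ℓ x).fderiv

/-- **`‖Dⁿ(exp ∘ ℓ)(x)‖ ≤ ‖e^{ℓ x}‖ ‖ℓ‖ⁿ`** for a continuous `ℝ`-linear form `ℓ : E → ℂ`
(induction on `n`: `D(exp ∘ ℓ) = (c ↦ c • ℓ) ∘ (exp ∘ ℓ)`). [folklore] -/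
theorem norm_iteratedFDeriv_cexp_comp_le (ℓ : E →L[ℝ] ℂ) (n : ℕ) (x : E) :
    ‖iteratedFDeriv ℝ n (fun x => exp (ℓ x)) x‖ ≤ ‖exp (ℓ x)‖ * ‖ℓ‖ ^ n := by
  induction n generalizing x with
  | zero => simp
  | succ n ih =>
    -- the `ℝ`-linear map `c ↦ c • ℓ`
    set g : ℂ →L[ℝ] (E →L[ℝ] ℂ) :=
      (ContinuousLinearMap.lsmul ℝ ℂ : ℂ →L[ℝ] (E →L[ℝ] ℂ) →L[ℝ] (E →L[ℝ] ℂ)).flip ℓ with hg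
    have hg_apply : ∀ c, g c = c • ℓ := fun c => rfl
    have hg_norm : ‖g‖ ≤ ‖ℓ‖ := by
      refine ContinuousLinearMap.opNorm_le_bound _ (norm_nonneg _) fun c => ?_
      rw [hg_apply, norm_smul, mul_comm]
    rw [← norm_iteratedFDeriv_fderiv, fderiv_cexp_comp]
    have hcomp : (fun x => exp (ℓ x) • ℓ) = g ∘ fun x => exp (ℓ x) := by
      funext y
      simp [hg_apply]
    rw [hcomp, g.iteratedFDeriv_comp_left (contDiff_cexp_comp ℓ).contDiffAt
      (by exact_mod_cast le_top)]
    calc ‖g.compContinuousMultilinearMap (iteratedFDeriv ℝ n (fun x => exp (ℓ x)) x)‖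
        ≤ ‖g‖ * ‖iteratedFDeriv ℝ n (fun x => exp (ℓ x)) x‖ :=
          ContinuousLinearMap.norm_compContinuousMultilinearMap_le _ _
      _ ≤ ‖ℓ‖ * (‖exp (ℓ x)‖ * ‖ℓ‖ ^ n) :=
          mul_le_mul hg_norm (ih x) (norm_nonneg _) (norm_nonneg _)
      _ = ‖exp (ℓ x)‖ * ‖ℓ‖ ^ (n + 1) := by ring

/-- The same bound with `‖e^{ℓ x}‖ = e^{Re ℓ x}`. [folklore] -/
theorem norm_iteratedFDeriv_cexp_comp_le' (ℓ : E →L[ℝ] ℂ) (n : ℕ) (x : E) :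
    ‖iteratedFDeriv ℝ n (fun x => exp (ℓ x)) x‖ ≤ Real.exp (ℓ x).re * ‖ℓ‖ ^ n := by
  rw [← Complex.norm_exp]
  exact norm_iteratedFDeriv_cexp_comp_le ℓ n x

/-- A continuous linear map has vanishing derivatives of order `≥ 2`. [folklore] -/
theorem iteratedFDeriv_clm_eq_zero {F : Type*} [NormedAddCommGroup F] [NormedSpace ℝ F]
    (ℓ : E →L[ℝ] F) {n : ℕ} (hn : 2 ≤ n) (x : E) : iteratedFDeriv ℝ n ℓ x = 0 := by
  obtain ⟨m, rfl⟩ : ∃ m, n = m + 2 := ⟨n - 2, by omega⟩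
  have h : iteratedFDeriv ℝ (m + 2) ℓ x = 0 ↔ ‖iteratedFDeriv ℝ (m + 2) ℓ x‖ = 0 := norm_eq_zero.symm
  have hf : fderiv ℝ (⇑ℓ) = fun _ => ℓ := funext fun y => ℓ.fderiv
  rw [h, ← norm_iteratedFDeriv_fderiv, hf, iteratedFDeriv_succ_const]
  simp

/-- In positive order the derivatives of `exp ∘ ℓ − c` are those of `exp ∘ ℓ`. [folklore] -/
theorem iteratedFDeriv_cexp_comp_sub_const (ℓ : E →L[ℝ] ℂ) (c : ℂ) {n : ℕ} (hn : n ≠ 0) (x : E) :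
    iteratedFDeriv ℝ n (fun x => exp (ℓ x) - c) x = iteratedFDeriv ℝ n (fun x => exp (ℓ x)) x := by
  have h := iteratedFDeriv_sub_apply (i := n) ((contDiff_cexp_comp ℓ).contDiffAt (x := x))
    (contDiffAt_const (c := c))
  rw [show (fun x => exp (ℓ x) - c) = (fun x => exp (ℓ x)) - fun _ => c from rfl, h,
    iteratedFDeriv_const_of_ne hn, Pi.zero_apply, sub_zero]

/-- **Derivatives of `exp ∘ ℓ − 1`**: order `0`, `‖e^{ℓx} − 1‖ ≤ ‖ℓ x‖ e^{max(Re ℓx, 0)}`; order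
`n ≥ 1`, `≤ e^{Re ℓx} ‖ℓ‖ⁿ`. [folklore] -/
theorem norm_iteratedFDeriv_cexp_comp_sub_one_le (ℓ : E →L[ℝ] ℂ) (n : ℕ) (x : E) :
    ‖iteratedFDeriv ℝ n (fun x => exp (ℓ x) - 1) x‖ ≤
      (if n = 0 then ‖ℓ x‖ else ‖ℓ‖ ^ n) * Real.exp (max (ℓ x).re 0) := by
  rcases eq_or_ne n 0 with rfl | hn
  · simpa using norm_cexp_sub_one_le (ℓ x)
  · rw [if_neg hn, iteratedFDeriv_cexp_comp_sub_const ℓ 1 hn]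
    calc ‖iteratedFDeriv ℝ n (fun x => exp (ℓ x)) x‖ ≤ Real.exp (ℓ x).re * ‖ℓ‖ ^ n :=
          norm_iteratedFDeriv_cexp_comp_le' ℓ n x
      _ ≤ Real.exp (max (ℓ x).re 0) * ‖ℓ‖ ^ n := by gcongr; exact le_max_left _ _
      _ = ‖ℓ‖ ^ n * Real.exp (max (ℓ x).re 0) := mul_comm _ _

/-- **Derivatives of `exp ∘ ℓ − 1 − ℓ`**: order `0`, `≤ ‖ℓ x‖² e^{max(Re ℓx,0)}`; order `1`,
`≤ ‖ℓ x‖ ‖ℓ‖ e^{max(Re ℓx, 0)}`; order `n ≥ 2`, `≤ e^{Re ℓx} ‖ℓ‖ⁿ`. Recorded in the weaker uniform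
form valid when `‖ℓ‖ ≤ 1`: `≤ ‖ℓ‖² (1 + ‖x‖)² e^{max(Re ℓx, 0)}` in every order. [folklore] -/
theorem norm_iteratedFDeriv_cexp_comp_sub_one_sub_le (ℓ : E →L[ℝ] ℂ) (hℓ : ‖ℓ‖ ≤ 1) (n : ℕ)
    (x : E) :
    ‖iteratedFDeriv ℝ n (fun x => exp (ℓ x) - 1 - ℓ x) x‖ ≤
      ‖ℓ‖ ^ 2 * (1 + ‖x‖) ^ 2 * Real.exp (max (ℓ x).re 0) := by
  have hℓx : ‖ℓ x‖ ≤ ‖ℓ‖ * ‖x‖ := ℓ.le_opNorm x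
  have hx1 : ‖x‖ ≤ 1 + ‖x‖ := by linarith [norm_nonneg x]
  have hℓx' : ‖ℓ x‖ ≤ ‖ℓ‖ * (1 + ‖x‖) := hℓx.trans (by gcongr)
  have hE : 1 ≤ Real.exp (max (ℓ x).re 0) := Real.one_le_exp (le_max_right _ _)
  rcases Nat.lt_or_ge n 2 with hn | hn
  · interval_cases n
    · -- order 0
      rw [norm_iteratedFDeriv_zero]
      calc ‖exp (ℓ x) - 1 - ℓ x‖ ≤ ‖ℓ x‖ ^ 2 * Real.exp (max (ℓ x).re 0) :=
            norm_cexp_sub_one_sub_le (ℓ x)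
        _ ≤ (‖ℓ‖ * ‖x‖) ^ 2 * Real.exp (max (ℓ x).re 0) := by gcongr
        _ ≤ (‖ℓ‖ * (1 + ‖x‖)) ^ 2 * Real.exp (max (ℓ x).re 0) := by gcongr
        _ = ‖ℓ‖ ^ 2 * (1 + ‖x‖) ^ 2 * Real.exp (max (ℓ x).re 0) := by ring
    · -- order 1
      have hd : HasFDerivAt (fun x => exp (ℓ x) - 1 - ℓ x) ((exp (ℓ x) - 1) • ℓ) x :=
        (((hasFDerivAt_cexp_comp ℓ x).sub_const 1).sub ℓ.hasFDerivAt).congr_fderiv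
          (by ext v; simp [sub_mul])
      rw [← norm_iteratedFDeriv_fderiv, norm_iteratedFDeriv_zero, hd.fderiv]
      calc ‖(exp (ℓ x) - 1) • ℓ‖ = ‖exp (ℓ x) - 1‖ * ‖ℓ‖ := norm_smul _ _
        _ ≤ ‖ℓ x‖ * Real.exp (max (ℓ x).re 0) * ‖ℓ‖ := by
            gcongr; exact norm_cexp_sub_one_le (ℓ x)
        _ ≤ ‖ℓ‖ * (1 + ‖x‖) * Real.exp (max (ℓ x).re 0) * ‖ℓ‖ := by gcongr
        _ = ‖ℓ‖ ^ 2 * (1 + ‖x‖) * Real.exp (max (ℓ x).re 0) := by ring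
        _ ≤ ‖ℓ‖ ^ 2 * (1 + ‖x‖) ^ 2 * Real.exp (max (ℓ x).re 0) := by
            gcongr
            nlinarith [norm_nonneg x]
  · -- order ≥ 2
    have hsplit : (fun x => exp (ℓ x) - 1 - ℓ x) = (fun x => exp (ℓ x) - 1) - ℓ := rfl
    rw [hsplit, iteratedFDeriv_sub_apply (((contDiff_cexp_comp ℓ).sub contDiff_const).contDiffAt)
      ℓ.contDiff.contDiffAt, iteratedFDeriv_clm_eq_zero ℓ hn, sub_zero,
      iteratedFDeriv_cexp_comp_sub_const ℓ 1 (by omega)]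
    calc ‖iteratedFDeriv ℝ n (fun x => exp (ℓ x)) x‖ ≤ Real.exp (ℓ x).re * ‖ℓ‖ ^ n :=
          norm_iteratedFDeriv_cexp_comp_le' ℓ n x
      _ ≤ Real.exp (max (ℓ x).re 0) * ‖ℓ‖ ^ 2 :=
          mul_le_mul (Real.exp_le_exp.2 (le_max_left _ _))
            (pow_le_pow_of_le_one (norm_nonneg _) hℓ hn) (by positivity) (by positivity)
      _ ≤ Real.exp (max (ℓ x).re 0) * ‖ℓ‖ ^ 2 * (1 + ‖x‖) ^ 2 := by
          refine le_mul_of_one_le_right (by positivity) ?_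
          nlinarith [norm_nonneg x]
      _ = ‖ℓ‖ ^ 2 * (1 + ‖x‖) ^ 2 * Real.exp (max (ℓ x).re 0) := by ring

end ExpLinear

/-! ### Leibniz bound with uniform constants -/

/-- **Leibniz bound**: if `‖Dⁱf(x)‖ ≤ B_f` and `‖Dⁱg(x)‖ ≤ B_g` for all `i ≤ n` then
`‖Dⁿ(fg)(x)‖ ≤ 2ⁿ B_f B_g` (`∑ᵢ C(n, i) = 2ⁿ`). [folklore] -/
theorem norm_iteratedFDeriv_mul_le_of_le {E : Type*} [NormedAddCommGroup E] [NormedSpace ℝ E]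
    {f g : E → ℂ} (hf : ContDiff ℝ ∞ f) (hg : ContDiff ℝ ∞ g) {n : ℕ} {x : E} {Bf Bg : ℝ}
    (hBf : ∀ i ≤ n, ‖iteratedFDeriv ℝ i f x‖ ≤ Bf) (hBg : ∀ i ≤ n, ‖iteratedFDeriv ℝ i g x‖ ≤ Bg) :
    ‖iteratedFDeriv ℝ n (fun y => f y * g y) x‖ ≤ 2 ^ n * Bf * Bg := by
  have h0f : 0 ≤ Bf := (norm_nonneg _).trans (hBf 0 (Nat.zero_le _))
  have h := norm_iteratedFDeriv_mul_le (n := n) hf hg x (by exact_mod_cast le_top)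
  refine h.trans ?_
  calc ∑ i ∈ Finset.range (n + 1),
        (n.choose i : ℝ) * ‖iteratedFDeriv ℝ i f x‖ * ‖iteratedFDeriv ℝ (n - i) g x‖
      ≤ ∑ i ∈ Finset.range (n + 1), (n.choose i : ℝ) * Bf * Bg := by
        refine Finset.sum_le_sum fun i hi => ?_
        have hi' : i ≤ n := Nat.lt_succ_iff.1 (Finset.mem_range.1 hi)
        have := hBf i hi'
        have := hBg (n - i) (Nat.sub_le _ _)
        gcongr
    _ = 2 ^ n * Bf * Bg := by
        rw [← Finset.sum_mul, ← Finset.sum_mul]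
        congr 1
        congr 1
        have := Nat.sum_range_choose n
        exact_mod_cast this

/-! ### Schwartz decay from exponential bounds -/

/-- `(1 + t)^m e^{-ct} ≤ m! e^c / c^m` for `t ≥ 0`, `c > 0` (from `yᵐ/m! ≤ eʸ` at `y = c(1+t)`).
[folklore] -/
theorem one_add_pow_mul_exp_neg_le {c : ℝ} (hc : 0 < c) (m : ℕ) {t : ℝ} (ht : 0 ≤ t) :
    (1 + t) ^ m * Real.exp (-(c * t)) ≤ m.factorial / c ^ m * Real.exp c := by
  have h := Real.pow_div_factorial_le_exp (x := c * (1 + t)) (by positivity) m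
  rw [div_le_iff₀ (by positivity), mul_pow, mul_add, mul_one, Real.exp_add] at h
  have hcm : 0 < c ^ m := pow_pos hc m
  rw [div_mul_eq_mul_div, le_div_iff₀ hcm]
  have key : (1 + t) ^ m * Real.exp (-(c * t)) * c ^ m * Real.exp (c * t) ≤
      m.factorial * Real.exp c * Real.exp (c * t) := by
    calc (1 + t) ^ m * Real.exp (-(c * t)) * c ^ m * Real.exp (c * t)
        = c ^ m * (1 + t) ^ m * (Real.exp (-(c * t)) * Real.exp (c * t)) := by ring
      _ = c ^ m * (1 + t) ^ m := by rw [← Real.exp_add, neg_add_cancel, Real.exp_zero, mul_one]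
      _ ≤ Real.exp c * Real.exp (c * t) * m.factorial := h
      _ = m.factorial * Real.exp c * Real.exp (c * t) := by ring
  exact le_of_mul_le_mul_right key (Real.exp_pos _)

/-- **Explicit Schwartz seminorm bound from an exponential bound**: if
`‖Dⁿf(x)‖ ≤ C (1 + ‖x‖)^N e^{-c‖x‖}` for all `x` then
`‖x‖ᵏ ‖Dⁿf(x)‖ ≤ C (k+N)! e^c / c^{k+N}`. [folklore] -/
theorem pow_mul_norm_le_of_exp_bound {E F : Type*} [NormedAddCommGroup E] [NormedAddCommGroup F]
    {D : E → F} {c C : ℝ} (hc : 0 < c) (hC : 0 ≤ C) {N : ℕ}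
    (h : ∀ x, ‖D x‖ ≤ C * (1 + ‖x‖) ^ N * Real.exp (-(c * ‖x‖))) (k : ℕ) (x : E) :
    ‖x‖ ^ k * ‖D x‖ ≤ C * ((k + N).factorial / c ^ (k + N) * Real.exp c) := by
  have hx1 : ‖x‖ ≤ 1 + ‖x‖ := by linarith [norm_nonneg x]
  calc ‖x‖ ^ k * ‖D x‖ ≤ (1 + ‖x‖) ^ k * (C * (1 + ‖x‖) ^ N * Real.exp (-(c * ‖x‖))) := by
        gcongr
        exact h x
    _ = C * ((1 + ‖x‖) ^ (k + N) * Real.exp (-(c * ‖x‖))) := by ring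
    _ ≤ C * ((k + N).factorial / c ^ (k + N) * Real.exp c) :=
        mul_le_mul_of_nonneg_left (one_add_pow_mul_exp_neg_le hc (k + N) (norm_nonneg x)) hC

/-- **Schwartz decay from exponential bounds**: a smooth function all of whose derivatives are
`O((1 + ‖x‖)^N e^{-c‖x‖})` (some `N`, `c > 0` fixed) has the decay property of a Schwartz
function. [folklore] -/
theorem schwartz_decay_of_exp_bound {E F : Type*} [NormedAddCommGroup E] [NormedSpace ℝ E]
    [NormedAddCommGroup F] [NormedSpace ℝ F] {f : E → F} {c : ℝ} (hc : 0 < c)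
    (h : ∀ n : ℕ, ∃ (C : ℝ) (N : ℕ), ∀ x, ‖iteratedFDeriv ℝ n f x‖ ≤
      C * (1 + ‖x‖) ^ N * Real.exp (-(c * ‖x‖))) :
    ∀ k n : ℕ, ∃ C : ℝ, ∀ x, ‖x‖ ^ k * ‖iteratedFDeriv ℝ n f x‖ ≤ C := by
  intro k n
  obtain ⟨C, N, hCN⟩ := h n
  have hC : 0 ≤ C := by
    have h0 := hCN 0
    have hpos : 0 < (1 + ‖(0 : E)‖) ^ N * Real.exp (-(c * ‖(0 : E)‖)) := by positivity
    nlinarith [norm_nonneg (iteratedFDeriv ℝ n f 0)]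
  exact ⟨_, pow_mul_norm_le_of_exp_bound hc hC hCN k⟩

/-- The corresponding bound on the Schwartz seminorms of a Schwartz function. [folklore] -/
theorem seminorm_le_of_exp_bound {E F : Type*} [NormedAddCommGroup E] [NormedSpace ℝ E]
    [NormedAddCommGroup F] [NormedSpace ℝ F] [NormedSpace ℂ F] [SMulCommClass ℝ ℂ F]
    (f : SchwartzMap E F) {c C : ℝ} (hc : 0 < c) (hC : 0 ≤ C) {N : ℕ} {n : ℕ}
    (h : ∀ x, ‖iteratedFDeriv ℝ n f x‖ ≤ C * (1 + ‖x‖) ^ N * Real.exp (-(c * ‖x‖))) (k : ℕ) :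
    SchwartzMap.seminorm ℂ k n f ≤ C * ((k + N).factorial / c ^ (k + N) * Real.exp c) :=
  SchwartzMap.seminorm_le_bound ℂ k n f (by positivity) (pow_mul_norm_le_of_exp_bound hc hC h k)

end Literature.Analysis.Distribution
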